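import Literature.NumberTheory.ComplexMultiplication.CMOrderDiscriminant
import Literature.NumberTheory.ComplexMultiplication.CMOrderFiniteIndexSubrings
import Literature.NumberTheory.ComplexMultiplication.CMOrderBassCharacterization
import Mathlib.GroupTheory.SpecificGroups.ZGroup
import HarnessLib

/-!
# GREITHER 1982 THEOREM 3.6: an order whose discriminant is fourth-power-free is an IG2-ring (a Bass order)

Family `hodge`, lane `lit-hodgefound` (Track 2 foundations library; seat p15, row g31-#2), topic
`Literature/NumberTheory/ComplexMultiplication`, namespaces `Literature.NumberTheory.ComplexMultiplication.EndOrder`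
(§1–§3: the order `𝔯 = endOrder ρ ⊆ 𝒪_K` of ANY representation `ρ : K →ₐ[ℚ] Matrix ι ι ℚ`; its index
`[𝒪_K : 𝔯] = (toRingOfIntegers ρ).range.toAddSubgroup.index` and discriminant `Algebra.discr ℤ b` of a `ℤ`-basis
`b`, as in `CMOrderDiscriminant`; the maximal order as a fractional ideal `M` with `↑M = range (algebraMap (𝓞 K) K)`)
and `….CMTypeLattice` (§4: `S = endOrder (M_μ)` for a `ℚ`-basis `μ` of `K`, where PROPOSITION 4.6 of
[Marseglia2024CMType] is packaged, `CMOrderBassCharacterization`).  THEOREMS ONLY: no definition, no instance, no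
notation, no named fact (net Literature debt `0`).

## Source, VERBATIM

C. Greither, *On the two generator problem for the ideals of a one-dimensional ring*, J. Pure Appl. Algebra 24
(1982) 265–276 [Greither1982TwoGenerator] (held `paper:doi-10-1016-0022-4049-82-90044-5`), §3, p. 273 (chunk
p0009): "3.6. Theorem. Let `K` be a number field (i.e. `[K : ℚ] < ∞`), and `R ⊂ K` an order such that `disk(R)` is
fourth-power-free in `ℤ`. Then `R` is an IG2-ring.  Proof. Recall the definition of the discriminant `disk(R)`:
Let `x₁, …, xₙ` be a `ℤ`-basis of `R`, and `tr = tr_{K|ℚ}` the trace. Then `disk(R) := det(tr(xᵢxⱼ) | i,j = 1, …, n)`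
is in `ℤ` and independent of the choice of the basis `(xᵢ)`. If `S` is the maximal order of `K`, `D_K := disk(S)`
is also called the discriminant of `K`. Now let `y₁, …, yₙ` be a base of `S`, and write
`(x₁, …, xₙ) = (y₁, …, yₙ)·A`, where `A` is an `n × n`-matrix over `ℤ`. As is well known,
`disk(R) = det(A)²·disk(S)`. But we know that `disk(R)` is free of fourth powers, whence `det(A)` has to be
square free. On the other hand, `|det(A)| = ord(S/R)`, and (since abelian groups of finite square free order are
cyclic) it follows: `S` is 2-generated as an `R`-module, and by Theorem 2.3, `R` is IG2."; §2, p. 268: "Let us call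
`R` an IG2-ring, if every ideal of `R` is 2-generated […] 2.3. Theorem. […] the following four conditions are
equivalent: (a) `R` is a Q-ring [`S/R` is a cyclic `R`-module] […] (c) `R` is IG2. (d) `R` is a Bass ring.
(e) Every ring between `R` and `S` is Gorenstein"; §3, p. 273: "3.9. Example. The criterion in Theorem 3.6 is of
course not necessary".

## The formalisation

The printed proof, step by step: §1 `disk(R) = [𝒪_K : R]²·D_K` is `CMOrderDiscriminant.discr_eq_index_sq_mul_discr`
(STEVENHAGEN (7-3)), so a prime `p` with `p² ∣ [𝒪_K : R]` gives `p⁴ ∣ disk(R)` and a fourth-power-free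
discriminant forces a square-free index (**`squarefree_index_of_forall_not_pow_four_dvd_discr`**); §2 «abelian
groups of finite square free order are cyclic» — a finite group of square-free order is a Z-group (Mathlib
`IsZGroup.of_squarefree`) and an abelian Z-group is cyclic — so `𝒪_K/R` is cyclic
(`isAddCyclic_quotient_range_of_squarefree_index`); §3 a generator `ω̄` of `𝒪_K/R` gives `𝒪_K = R + ℤω = R·1 + R·ω`,
i.e. «`S` is 2-generated as an `R`-module» in the tree's spelling `↑M = Submodule.span R {1, ω}`
(**`exists_coe_eq_span_pair_of_isAddCyclic_quotient_range`**, `exists_coe_eq_span_pair_of_squarefree_index`,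
**`exists_coe_eq_span_pair_of_forall_not_pow_four_dvd_discr`**); §4 «by Theorem 2.3, `R` is IG2»: for
`S = endOrder (M_μ)` the tree's PROPOSITION 4.6 ⟺'s turn `𝒪_K = S + Sω` into «every fractional `S`-ideal is
generated by two elements» (**`CMTypeLattice.spanFinrank_coe_le_two_of_forall_not_pow_four_dvd_discr`**, THEOREM 3.6
as printed; `CMTypeLattice.spanFinrank_le_two_of_forall_not_pow_four_dvd_discr` for the integral ideals `J ⊆ S`) and «every over-order `T = endOrder (M_ν) ⊇ S` is Gorenstein» (`Tᵗ` invertible,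
`CMTypeLattice.isUnit_traceDual_of_forall_not_pow_four_dvd_discr`, THEOREM 2.3 (c) ⟺ (e)); §5 checks the
hypothesis on the tree's order `ℤ[√-3] ⊂ ℚ(ζ₃)` (`Δ = −12`, `CMOrderDiscriminant` §4): `EisensteinTwo.spanFinrank_coe_le_two`.
-/

open scoped nonZeroDivisors NumberField
open NumberField Module FractionalIdeal
open Submodule (traceDual)

namespace Literature.NumberTheory.ComplexMultiplication

namespace EndOrder

variable {K : Type} [Field K] [NumberField K]
variable {ι : Type} [Fintype ι] [DecidableEq ι] [Nonempty ι] {ρ : K →ₐ[ℚ] Matrix ι ι ℚ}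

/-! ## §1 «`disk(R) = det(A)²·disk(S)` … whence `det(A) = ord(S/R)` has to be square free» -/

/-- **GREITHER 1982 THEOREM 3.6, first step: if `Δ(𝔯)` is fourth-power-free then the index `[𝒪_K : 𝔯]` is
square-free** («As is well known, `disk(R) = det(A)²·disk(S)`. But we know that `disk(R)` is free of fourth powers,
whence `det(A)` has to be square free. On the other hand, `|det(A)| = ord(S/R)`»; the index formula is
`discr_eq_index_sq_mul_discr`). [cite: Greither1982TwoGenerator, §3 Thm. 3.6 (proof), p. 273] -/
theorem squarefree_index_of_forall_not_pow_four_dvd_discr {κ : Type*} [Fintype κ] [DecidableEq κ]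
    (b : Basis κ ℤ (endOrder ρ)) (h4 : ∀ p : ℕ, p.Prime → ¬ (p : ℤ) ^ 4 ∣ Algebra.discr ℤ b) :
    Squarefree (toRingOfIntegers ρ).range.toAddSubgroup.index := by
  rw [Nat.squarefree_iff_prime_squarefree]
  intro p hp hpp
  refine h4 p hp ?_
  rw [discr_eq_index_sq_mul_discr b]
  refine Dvd.dvd.mul_right ?_ _
  have h2 : ((p * p : ℕ) : ℤ) ^ 2 ∣ ((toRingOfIntegers ρ).range.toAddSubgroup.index : ℤ) ^ 2 :=
    pow_dvd_pow_of_dvd (Int.natCast_dvd_natCast.2 hpp) 2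
  have h4' : (p : ℤ) ^ 4 = ((p * p : ℕ) : ℤ) ^ 2 := by push_cast; ring
  rwa [h4']

/-! ## §2 «abelian groups of finite square free order are cyclic» -/

/-- **`𝒪_K/𝔯` is cyclic when `[𝒪_K : 𝔯]` is square-free** («since abelian groups of finite square free order are
cyclic»: a finite group of square-free order is a Z-group, Mathlib's `IsZGroup.of_squarefree`, and an abelian
Z-group is cyclic). [cite: Greither1982TwoGenerator, §3 Thm. 3.6 (proof), p. 273] -/
theorem isAddCyclic_quotient_range_of_squarefree_index
    (hsq : Squarefree (toRingOfIntegers ρ).range.toAddSubgroup.index) :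
    IsAddCyclic (𝓞 K ⧸ (toRingOfIntegers ρ).range.toAddSubgroup) := by
  rw [AddSubgroup.index_eq_card] at hsq
  haveI : Finite (𝓞 K ⧸ (toRingOfIntegers ρ).range.toAddSubgroup) := Nat.finite_of_card_ne_zero hsq.ne_zero
  haveI : IsZGroup (Multiplicative (𝓞 K ⧸ (toRingOfIntegers ρ).range.toAddSubgroup)) :=
    IsZGroup.of_squarefree hsq
  exact isCyclic_multiplicative_iff.mp inferInstance

/-! ## §3 «it follows: `S` is 2-generated as an `R`-module» — `𝒪_K = 𝔯 + 𝔯ω` -/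

/-- **A cyclic quotient `𝒪_K/𝔯` makes `𝒪_K` two-generated over `𝔯`: `𝒪_K = 𝔯·1 + 𝔯·ω`** for (any lift `ω` of) a
generator of `𝒪_K/𝔯` — every `a ∈ 𝒪_K` is `s + nω` with `s ∈ 𝔯`, `n ∈ ℤ` («it follows: `S` is 2-generated as an
`R`-module»; in the tree's spelling of «`𝒪_K/S` is cyclic», `↑M = Submodule.span 𝔯 {1, ω}` for the maximal order
`M`). [cite: Greither1982TwoGenerator, §3 Thm. 3.6 (proof), p. 273; §1 («`R` is a Q-ring iff `S/R` is a cyclic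
`R`-module»), p. 266] -/
theorem exists_coe_eq_span_pair_of_isAddCyclic_quotient_range
    [hc : IsAddCyclic (𝓞 K ⧸ (toRingOfIntegers ρ).range.toAddSubgroup)]
    {M : FractionalIdeal (endOrder ρ)⁰ K} (hMO : (M : Set K) = (algebraMap (𝓞 K) K).range) :
    ∃ ω ∈ M, (M : Submodule (endOrder ρ) K) = Submodule.span (endOrder ρ) {1, ω} := by
  obtain ⟨g, hg⟩ := hc.exists_generator
  obtain ⟨ω₀, rfl⟩ := QuotientAddGroup.mk_surjective g
  have hmemM : ∀ x : K, x ∈ (M : Submodule (endOrder ρ) K) ↔ ∃ a : 𝓞 K, (a : K) = x := fun x ↦ by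
    rw [mem_coe, ← SetLike.mem_coe, hMO]
    exact ⟨fun ⟨a, ha⟩ ↦ ⟨a, ha⟩, fun ⟨a, ha⟩ ↦ ⟨a, ha⟩⟩
  have hωM : ((ω₀ : 𝓞 K) : K) ∈ M := (hmemM _).2 ⟨ω₀, rfl⟩
  have h1M : (1 : K) ∈ M := (hmemM _).2 ⟨1, by simp⟩
  refine ⟨(ω₀ : K), hωM, le_antisymm (fun x hx ↦ ?_) ?_⟩
  · obtain ⟨a, rfl⟩ := (hmemM x).1 hx
    -- `ā = n ω̄₀` in `𝒪_K/𝔯`, so `s := a - n ω₀ ∈ 𝔯`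
    obtain ⟨n, hn⟩ := AddSubgroup.mem_zmultiples_iff.1 (hg (QuotientAddGroup.mk a))
    rw [← QuotientAddGroup.mk_zsmul, QuotientAddGroup.eq_iff_sub_mem, Subring.mem_toAddSubgroup,
      mem_range_toRingOfIntegers_iff] at hn
    rw [Submodule.mem_span_pair]
    refine ⟨-⟨_, hn⟩, (n : endOrder ρ), ?_⟩
    simp only [Subring.smul_def, smul_eq_mul, mul_one]
    push_cast
    ring
  · rw [Submodule.span_le]
    rintro x (rfl | rfl)
    · exact h1M
    · exact hωM

/-- **Square-free index makes `𝒪_K` two-generated over `𝔯`: `[𝒪_K : 𝔯]` square-free ⟹ `𝒪_K = 𝔯 + 𝔯ω`.**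
[cite: Greither1982TwoGenerator, §3 Thm. 3.6 (proof), p. 273] -/
theorem exists_coe_eq_span_pair_of_squarefree_index
    (hsq : Squarefree (toRingOfIntegers ρ).range.toAddSubgroup.index)
    {M : FractionalIdeal (endOrder ρ)⁰ K} (hMO : (M : Set K) = (algebraMap (𝓞 K) K).range) :
    ∃ ω ∈ M, (M : Submodule (endOrder ρ) K) = Submodule.span (endOrder ρ) {1, ω} := by
  haveI := isAddCyclic_quotient_range_of_squarefree_index hsq
  exact exists_coe_eq_span_pair_of_isAddCyclic_quotient_range hMO

/-- **GREITHER 1982 THEOREM 3.6, the module-theoretic conclusion for ANY order `𝔯 = endOrder ρ`: if `Δ(𝔯)` (the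
discriminant of any `ℤ`-basis `b` of `𝔯`) is fourth-power-free then `𝒪_K = 𝔯 + 𝔯ω` for some `ω`** («`S` is
2-generated as an `R`-module», i.e. `R` is a Q-ring). [cite: Greither1982TwoGenerator, §3 Thm. 3.6 and proof,
p. 273] -/
theorem exists_coe_eq_span_pair_of_forall_not_pow_four_dvd_discr {κ : Type*} [Fintype κ] [DecidableEq κ]
    (b : Basis κ ℤ (endOrder ρ)) (h4 : ∀ p : ℕ, p.Prime → ¬ (p : ℤ) ^ 4 ∣ Algebra.discr ℤ b)
    {M : FractionalIdeal (endOrder ρ)⁰ K} (hMO : (M : Set K) = (algebraMap (𝓞 K) K).range) :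
    ∃ ω ∈ M, (M : Submodule (endOrder ρ) K) = Submodule.span (endOrder ρ) {1, ω} :=
  exists_coe_eq_span_pair_of_squarefree_index (squarefree_index_of_forall_not_pow_four_dvd_discr b h4) hMO

end EndOrder

/-! ## §4 «and by Theorem 2.3, `R` is IG2» — for `S = endOrder (M_μ)` -/

namespace CMTypeLattice

variable {K : Type} [Field K] [NumberField K]
variable {ι : Type} [Fintype ι] [DecidableEq ι] (μ : Basis ι ℚ K) [Nonempty ι]
variable [IsFractionRing (endOrder (Algebra.leftMulMatrix μ)) K]

/-- **GREITHER 1982 THEOREM 3.6 «Let `K` be a number field, and `R ⊂ K` an order such that `disk(R)` is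
fourth-power-free in `ℤ`. Then `R` is an IG2-ring»** for the order `S = endOrder (M_μ)`: if no fourth power of a
prime divides `Δ(S) = Algebra.discr ℤ b` (any `ℤ`-basis `b` of `S`), then every nonzero fractional `S`-ideal is
generated by two elements (`𝒪_K = S + Sω` by §3, then PROPOSITION 4.6 (iv) ⟹ «every ideal 2-generated», the
tree's `exists_coe_eq_span_pair_iff_forall_spanFinrank_coe_le_two` = THEOREM 2.3 (a) ⟹ (c)).
[cite: Greither1982TwoGenerator, §3 Thm. 3.6, p. 273; §2 Thm. 2.3 ((a) ⟹ (c)), p. 268] [cite: Marseglia2024CMType,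
§4 Prop. 4.6 ((iv) ⟹ (v)), pp. 10–11] -/
theorem spanFinrank_coe_le_two_of_forall_not_pow_four_dvd_discr {κ : Type*} [Fintype κ] [DecidableEq κ]
    (b : Basis κ ℤ (endOrder (Algebra.leftMulMatrix μ)))
    (h4 : ∀ p : ℕ, p.Prime → ¬ (p : ℤ) ^ 4 ∣ Algebra.discr ℤ b)
    {I : FractionalIdeal (endOrder (Algebra.leftMulMatrix μ))⁰ K} (hI : I ≠ 0) :
    (I : Submodule (endOrder (Algebra.leftMulMatrix μ)) K).spanFinrank ≤ 2 := by
  obtain ⟨M, -, -, hMO⟩ := EndOrder.exists_idempotent_coe_eq_range (ρ := Algebra.leftMulMatrix μ) (K := K)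
  exact (exists_coe_eq_span_pair_iff_forall_spanFinrank_coe_le_two μ hMO).1
    (EndOrder.exists_coe_eq_span_pair_of_forall_not_pow_four_dvd_discr b h4 hMO) I hI

/-- **THEOREM 3.6 in GREITHER's own words, «every ideal of `R` is 2-generated» (IG2 for the integral ideals):** if
`Δ(S)` is fourth-power-free then every ideal `J` of `S = endOrder (M_μ)` has `Submodule.spanFinrank J ≤ 2` (the
fractional statement read on `J ⊆ S ⊆ K`, `S → K` being injective). [cite: Greither1982TwoGenerator, §3 Thm. 3.6,
p. 273; §2 («Let us call `R` an IG2-ring, if every ideal of `R` is 2-generated»), p. 268] -/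
theorem spanFinrank_le_two_of_forall_not_pow_four_dvd_discr {κ : Type*} [Fintype κ] [DecidableEq κ]
    (b : Basis κ ℤ (endOrder (Algebra.leftMulMatrix μ)))
    (h4 : ∀ p : ℕ, p.Prime → ¬ (p : ℤ) ^ 4 ∣ Algebra.discr ℤ b) (J : Ideal (endOrder (Algebra.leftMulMatrix μ))) :
    Submodule.spanFinrank J ≤ 2 := by
  by_cases hJ : J = ⊥
  · subst hJ
    simp
  · have h := spanFinrank_coe_le_two_of_forall_not_pow_four_dvd_discr μ b h4
      (coeIdeal_ne_zero.2 hJ : (J : FractionalIdeal (endOrder (Algebra.leftMulMatrix μ))⁰ K) ≠ 0)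
    rwa [coe_coeIdeal, IsLocalization.coeSubmodule,
      Submodule.spanFinrank_map_eq_of_injective (Algebra.linearMap (endOrder (Algebra.leftMulMatrix μ)) K)
        (IsFractionRing.injective (endOrder (Algebra.leftMulMatrix μ)) K)] at h

/-- **GREITHER 1982 THEOREM 3.6 with THEOREM 2.3 (c) ⟺ (e) «every ring between `R` and `S` is Gorenstein»**: if
`Δ(S)` is fourth-power-free then the trace dual `Tᵗ` of every over-order `T = endOrder (M_ν) ⊇ S` is an invertible
fractional `T`-ideal (PROPOSITION 4.6 (iv) ⟹ (ii), `exists_coe_eq_span_pair_iff_forall_isUnit_traceDual_one`).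
[cite: Greither1982TwoGenerator, §3 Thm. 3.6, p. 273; §2 Thm. 2.3 ((a) ⟺ (e)), p. 268] [cite: Marseglia2024CMType,
§4 Prop. 4.6 ((iv) ⟹ (ii)), p. 10] -/
theorem isUnit_traceDual_of_forall_not_pow_four_dvd_discr {κ : Type*} [Fintype κ] [DecidableEq κ]
    (b : Basis κ ℤ (endOrder (Algebra.leftMulMatrix μ)))
    (h4 : ∀ p : ℕ, p.Prime → ¬ (p : ℤ) ^ 4 ∣ Algebra.discr ℤ b)
    {ν : Basis ι ℚ K} (hST : endOrder (Algebra.leftMulMatrix μ) ≤ endOrder (Algebra.leftMulMatrix ν))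
    {T' : FractionalIdeal (endOrder (Algebra.leftMulMatrix ν))⁰ K}
    (hT' : (T' : Submodule (endOrder (Algebra.leftMulMatrix ν)) K) =
      traceDual ℤ ℚ ((1 : FractionalIdeal (endOrder (Algebra.leftMulMatrix ν))⁰ K) :
        Submodule (endOrder (Algebra.leftMulMatrix ν)) K)) :
    IsUnit T' := by
  obtain ⟨M, -, -, hMO⟩ := EndOrder.exists_idempotent_coe_eq_range (ρ := Algebra.leftMulMatrix μ) (K := K)
  exact (exists_coe_eq_span_pair_iff_forall_isUnit_traceDual_one μ hMO).1
    (EndOrder.exists_coe_eq_span_pair_of_forall_not_pow_four_dvd_discr b h4 hMO) ν hST T' hT'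

/-- **Square-free index ⟹ IG2** (the criterion actually used inside the proof of THEOREM 3.6: `[𝒪_K : S]` square-free
⟹ `𝒪_K = S + Sω` ⟹ every fractional `S`-ideal is 2-generated). [cite: Greither1982TwoGenerator, §3 Thm. 3.6
(proof), p. 273; §2 Thm. 2.3 ((a) ⟹ (c)), p. 268] -/
theorem spanFinrank_coe_le_two_of_squarefree_index
    (hsq : Squarefree (EndOrder.toRingOfIntegers (Algebra.leftMulMatrix μ)).range.toAddSubgroup.index)
    {I : FractionalIdeal (endOrder (Algebra.leftMulMatrix μ))⁰ K} (hI : I ≠ 0) :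
    (I : Submodule (endOrder (Algebra.leftMulMatrix μ)) K).spanFinrank ≤ 2 := by
  obtain ⟨M, -, -, hMO⟩ := EndOrder.exists_idempotent_coe_eq_range (ρ := Algebra.leftMulMatrix μ) (K := K)
  exact (exists_coe_eq_span_pair_iff_forall_spanFinrank_coe_le_two μ hMO).1
    (EndOrder.exists_coe_eq_span_pair_of_squarefree_index hsq hMO) I hI

/-! ## §5 Validation on `ℤ[√-3] ⊂ ℚ(ζ₃)`: `Δ = −12` is fourth-power-free -/

namespace EisensteinTwo

/-- `Δ(ℤ[√-3]) = −12 = −2²·3` is fourth-power-free (`p⁴ ≥ 16 > 12`). [cite: Greither1982TwoGenerator, §3 («all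
orders in quadratic number fields are trivially IG2») and Thm. 3.6, p. 273] -/
theorem not_pow_four_dvd_discr {κ : Type*} [Fintype κ] [DecidableEq κ]
    (b : Basis κ ℤ (endOrder (Algebra.leftMulMatrix basis))) (p : ℕ) (hp : p.Prime) :
    ¬ (p : ℤ) ^ 4 ∣ Algebra.discr ℤ b := by
  intro h
  rw [discr_endOrder_basis_eq b] at h
  have h' : p ^ 4 ∣ 12 := by
    have h'' := Int.natAbs_dvd_natAbs.2 h
    simpa [Int.natAbs_pow] using h''
  have h16 : 2 ^ 4 ≤ p ^ 4 := Nat.pow_le_pow_left hp.two_le 4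
  have h12 := Nat.le_of_dvd (by norm_num) h'
  omega

/-- **THEOREM 3.6 applied to `ℤ[√-3]`: every nonzero fractional ideal of the non-maximal order
`ℤ[√-3] = endOrder (M_basis)` (index `2` in `ℤ[ζ₃]`) is generated by two elements** — GREITHER's «all orders in quadratic number
fields are trivially IG2», here obtained through the discriminant criterion. [cite: Greither1982TwoGenerator, §3
Thm. 3.6, p. 273] -/
theorem spanFinrank_coe_le_two {I : FractionalIdeal (endOrder (Algebra.leftMulMatrix basis))⁰ K₃} (hI : I ≠ 0) :
    (I : Submodule (endOrder (Algebra.leftMulMatrix basis)) K₃).spanFinrank ≤ 2 := by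
  haveI := isFractionRing_endOrder (Algebra.leftMulMatrix basis)
  obtain ⟨b, -⟩ := exists_basis_discr_eq
  exact spanFinrank_coe_le_two_of_forall_not_pow_four_dvd_discr basis b (not_pow_four_dvd_discr b) hI

end EisensteinTwo

end CMTypeLattice

end Literature.NumberTheory.ComplexMultiplication
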